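import Literature.MathematicalPhysics.QuantumFieldTheory.BalabanImbrieJaffe1984to88.BIJ88RTIterated
import Literature.MathematicalPhysics.QuantumFieldTheory.BalabanImbrieJaffe1984to88.BIJ85Integral14

/-!
# `BalabanImbrieJaffe1984to88.BIJ85Eq31ActionMap` — T. Bałaban, J. Imbrie, A. Jaffe, *Renormalization of the Higgs model: minimizers,
propagators and the stability of mean field theory*, Commun. Math. Phys. **97** (1985) 299–329 [BalabanImbrieJaffe1985], Sect. 3 p. 306:
**(3.1) `R : S → S^{(1)}`, (3.2) `R = 𝒮_L𝒯`** — the renormalization transformation AS A MAP ON UNIT-LATTICE ACTIONS, typed with a body on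
the torus carriers of record: `S^{(1)} := −log (𝒮_L𝒯 e^{−S})`, over p34's density-level `R = 𝒮𝒯` (`BIJ88RTIterated.rgStep`) and 𝒯 of (3.3)
(`BIJ85RT33.RTData.rt` on r18's `torusRTData`); with print's instance `S` = the unit-lattice action (1.1) (`BIJ85Integral14.S11`).

statement-level skeleton of published theorems with citation tags; proofs where landed; nothing here is a claim about the Yang–Mills mass gap

PDF held: `paper:balaban1985-cmp97-bij-higgs-minimizers` (journal page = PDF page + 298); p. 306 [PDF 8] read this session on the render
`HOME/lit-balaban-r15/pages/1985-cmp97-bij-higgs-minimizers-p008-x2.png` (×2) and on the text layer (`lit read … --pages 7-9`, `p0008.txt`).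

CITATION HEADER (lean-in-tree rule).  Part of the lit-balaban TYPED SKELETON (HOME `run/shared/lean/pub/lit-balaban/`), unit `lit-balaban-r15`
gen 17 (reader/typer and fold owner of C1 = [BalabanImbrieJaffe1985]; literature-prover-lit-balaban-r15-g17-0).  Serves row **`C1.Eq3.1-3.3`** of
`HOME/lit-balaban-r15/ROWS-C1.md` (head `typed p246318`: (3.3) typed at measure level by p34 `BIJ85RT33`, (3.2) `R = 𝒮_L𝒯` at DENSITY level by
p34 `BIJ88RTIterated.rgStep`/`rgIter`; the display (3.1) «R : S → S^{(1)}, S, S^{(1)} unit lattice actions» was the part read as a schema —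
this file types it at ACTION level).  Optional located member; the head is the fold owner's / lead's call.

THE PRINTED TEXT (p. 306 [PDF 8], verbatim).  *"3. The First Renormalization Step.  The renormalization transformation R defines a mapping
R : S → S^{(1)}, (3.1) where S, S^{(1)} are both unit lattice actions. This transformation involves two steps: (i) Integrate high momentum degrees
of freedom while fixing block spin averages. (ii) Rescale the resulting L-lattice action to the unit lattice. Thus we can write R = 𝒮_L𝒯, (3.2)
where 𝒯 is defined by (𝒯e^{−S})(v, ψ) = ∫ e^{−S(u,φ)} δ_{Ax}(u) δ(v/Qu) δ_H(ψ − Qφ) 𝒟u𝒟φ. (3.3) … Let 𝒢₀ denote the subgroup of gauge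
transformations which are specified by h's in (2.7) which are constant on each L-block B(y). These gauge transformations preserve the axial
gauge and affect only bonds on the unit lattice which connect different blocks. They generate the gauge group of the integral 𝒯(exp −S). …
The integral (3.2) therefore has the normalization property ∫ 𝒯e^{−S} 𝒟v𝒟ψ = ∫ e^{−S} 𝒟u𝒟φ, (3.7)"*.

READING (declared).  (a) Print DEFINES `𝒯` by its action on the Boltzmann weight `e^{−S}` ((3.3)) and `R = 𝒮_L𝒯` ((3.2)); the display (3.1)
names the induced map on actions: `S^{(1)}` is the unit-lattice action with `e^{−S^{(1)}} = R e^{−S} = 𝒮_L𝒯 e^{−S}`, i.e. `S^{(1)} = −log(𝒮_L𝒯 e^{−S})`.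
This file types exactly that: `boltz S = e^{−S}` (an action read as a density), `rAction S := −log ∘ Re ∘ (𝒮𝒯)(e^{−S})` with p34's
`rgStep = scaleStep c ∘ rtStep` (`rtStep` = the Radon–Nikodym transform (3.3) over r18's printed block averages `torusRTData` — (3.4) axial
forest, (2.10) `Qu`, (2.6) `Q(u)φ` — with the Gaussian `δ_H` (3.6) in r18's normalized form `gaussApprox` (parameter `a′ = aL^{d−2}`,
`BIJ88RenormTransf311.gaussWeight`'s docstring) followed by the gauge average of `BIJ88GaugeAverage`, an a.e.-null modification
(`rtStep_ae_eq_rt`); `scaleStep c` = `𝒮_L` on the block scalar field with its honest Jacobian, printed `c = L^{−(d−2)/2}`).  (b) CARRIERS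
(ruling G.5-1/S2): the unit lattice is the torus level `Balaban1983to89.Site P i`, the rescaled `L`-lattice is the next level `Site P (i+1)`
(in the `Setup` tower the block lattice is itself the next unit lattice; `𝒮_L` acts on the scalar field, `BIJ88RTIterated` §5); `u : GaugeField P i U1`
with the product Haar probability measure, `φ : HiggsField P i` with Lebesgue measure.  (c) «both unit lattice actions»: `S : Action P i` and
`R S : Action P (i+1)` are real functions of the gauge and scalar fields of consecutive unit lattices of the tower; the words of p. 306 used
downstream — the gauge invariance of `𝒯(exp −S)` and (3.7) — are kernel theorems here for `S^{(1)}` / `e^{−S}` (`jointInvariant_rAction`,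
`integral_rgStep_boltz`).

WHAT IS TYPED / PROVED (0 `sorry`; definitions with bodies + theorems; no `Prop`-valued fact; standard axioms).
* §1 `Action P i`; `boltz S = e^{−S}` as a `ℂ`-valued density (`boltz_apply`, `re_boltz`, `re_boltz_pos`, `im_boltz`, `boltz_ne_zero`,
  **`neg_log_re_boltz`**: `−log Re e^{−S} = S` — an action is recovered from its Boltzmann weight —, `measurable_boltz`, `jointInvariant_boltz`).
* §2 **(3.1)–(3.2) `rAction`**: `(R S)(v, ψ) := −log Re (𝒮𝒯 e^{−S})(v, ψ)`; `rAction_def`; **`exp_neg_rAction`**: `e^{−(R S)(v,ψ)} = Re (𝒮𝒯 e^{−S})(v,ψ)`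
  at every block configuration where the density is positive; **`measurable_rAction`** (`S^{(1)}` is a measurable function of `(v, ψ)`, for every
  `S`); **`jointInvariant_rAction`** (`S^{(1)}(v^h, hψ) = S^{(1)}(v, ψ)` for EVERY gauge transformation `h` of the block lattice, exactly and for
  every `S` — p. 306 *"They generate the gauge group of the integral 𝒯(exp −S)"*, for the gauge-averaged version of record);
  **`integral_rgStep_boltz`**: (3.7) for the weight, `∫dv dψ (𝒮𝒯 e^{−S}) = ∫𝒟u𝒟φ e^{−S}` for `S` jointly measurable and jointly gauge
  invariant with `e^{−S}` integrable (p34's `rgStep_regular`); **`isRT311_boltz`** ((3.3) for `e^{−S}` in r18's push-forward reading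
  `IsRT311 Qu Q(·)φ a e^{−S} (𝒯e^{−S})`, p34's `isRT311_rtStep`); `rActionIter`: `S^{(k)} := −log Re (R^k e^{−S})` over p34's `rgIter`
  (p. 309 *"the action which is produced after k renormalization transformations"*), `measurable_rActionIter`, `jointInvariant_rActionIter`.
* §3 PRINT'S INSTANCE: `S` = the unit-lattice action (1.1) of this paper, `BIJ85Integral14.S11 e(ε) λ(ε) μ² E` (r15 gen 11), for which
  **`boltz_S11_eq_rho0`** (`e^{−S}` IS r18's density `rho0` of [BalabanImbrieJaffe1988] (3.7) at `ε = 1`, observable `1`), hence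
  `measurable_boltz_S11`, `jointInvariant_boltz_S11`, **`integrable_boltz_S11`** (`λ(ε) > 0`), and **`integral_R_exp_neg_S11`**:
  `∫dv dψ (R e^{−S})(v, ψ) = ∫𝒟u𝒟φ e^{−S(u,φ)}` for the model's first renormalization step (every `e(ε)`, `μ²`, `E`, every `λ(ε) > 0`,
  Gaussian parameter `a > 0`, scaling `c > 0`, `d ≥ 2`, standing range `j + 1 ≤ m + K`); `S1` := `R S` for this `S` with
  `measurable_S1`, `jointInvariant_S1`, `exp_neg_S1`, `isRT311_exp_neg_S11`; `measurable_S11` (the action (1.1) is jointly measurable), and the `k`-fold instance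
  `Sk` := `S^{(k)}` of the model over `rgIter` with `Sk_zero`, `measurable_Sk`, `jointInvariant_Sk`, **`integral_Rk_exp_neg_S11`** ((3.7) along `R^k`).
* §4 **THE `δ_H` OF RECORD IS (3.6)**: **`gaussWeight_eq_deltaHKernel`** / **`gaussApprox_eq_deltaH`** — r18's normalized Gaussian of
  [BalabanImbrieJaffe1988] (3.11)–(3.12) (`gaussApprox a`, the `δ_H` inside `rtStep`/`rgStep` and every consumer of record) EQUALS p34's typed
  (3.6) `deltaH` at `a′ = aL^{d−2}` (kernel identity, every `a > 0`, `d ≥ 2`); `rtStep_eq_deltaH`, **`rAction_eq_deltaH`**: `S^{(1)} =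
  −log Re 𝒮_L[gaugeAvg 𝒯_{(3.6)} e^{−S}]` — (3.1)–(3.3) with the printed (3.4)–(3.6) end to end on the torus carriers.
HONEST SCOPE.  (i) POSITIVITY of the density `(𝒮𝒯 e^{−S})(v, ψ)` — hence finiteness of `S^{(1)}(v, ψ)` and `e^{−S^{(1)}} = R e^{−S}` at EVERY
`(v, ψ)` — is NOT claimed: print asserts none, and the density of record is a Radon–Nikodym version (gauge-averaged), which may vanish on a
`dv dψ`-null set; `exp_neg_rAction` is stated pointwise under the positivity hypothesis (where the density is `≤ 0`, `Real.log` returns its junk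
value and `S^{(1)}` carries no information).  (ii) Nothing of the small-field analysis ((3.8) ff.), no bound.  (iii) `δ_H`: the consumers of record use r18's
normalized Gaussian `gaussApprox a`; §4 PROVES it is (3.6) `deltaH` at `a′ = aL^{d−2}`, so no distance to print remains there (the free
parameter `a > 0` is renamed).  (iv) `δ(v/Qu)` (3.5) is read as the Radon–Nikodym density of the push-forward (the cell's convention F7,
HOME/SHARED-STRUCTURES) and `𝒯ρ` is taken in its gauge-averaged version (a.e. equal, `rtStep_ae_eq_rt`).
Re-declares nothing; imports Literature + Mathlib only.
-/

namespace Literature.MathematicalPhysics.QuantumFieldTheory.BalabanImbrieJaffe1984to88.BIJ85Eq31ActionMap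

open Literature.MathematicalPhysics.QuantumFieldTheory.Balaban1983to89
open BIJ88Sect3Statements (U1 toC actionU1 calE0 E0step)
open BIJ85Sect1Model (HiggsField)
open BIJ85RT33 (JointInvariant twist twist_apply ApproxDelta deltaH deltaHKernel siteGauss)
open BIJ88RenormTransf311 (gaussWeight)
open BIJ88RT311Exists (gaussApprox)
open BIJ88GaugeAverage (gaugeAvg)
open BIJ88RenormTransf311 (IsRT311 rho0 measurable_rho0 rho0_gaugeAct)
open BIJ88Expect32WellDefined (rho0_one integrable_rho0_one)
open BIJ88RTIterated (Dens rtStep rgStep rgIter scaleStep measurable_rtStep jointInvariant_rtStep measurable_scaleStep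
  jointInvariant_scaleStep rgStep_regular rgIter_regular isRT311_rtStep)
open BIJ85BlockAveragesTorus (qU qCov torusRTData)
open BIJ85Integral14 (S11 S11_eq_actionU1_one)
open GaugeField (gaugeAct)
open scoped BigOperators
open _root_.MeasureTheory Complex Function

noncomputable section

variable {P : Params} {i : ℕ}

/-! ## §1 Unit-lattice actions and their Boltzmann weights `e^{−S}` -/

/-- A **unit lattice action** (p. 306: *"S, S^{(1)} are both unit lattice actions"*): a real function `S(u, φ)` of the gauge field
`u : bonds → U(1)` and the scalar field `φ : sites → ℂ` of the level-`i` torus of the tower. [cite: BalabanImbrieJaffe1985, (3.1) p.306] -/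
abbrev Action (P : Params) (i : ℕ) : Type := GaugeField P i U1 → HiggsField P i → ℝ

/-- The Boltzmann weight `e^{−S(u,φ)}` of an action, read as a (`ℂ`-valued) density on which `𝒯` (3.3) and `R = 𝒮_L𝒯` (3.2) act.
[cite: BalabanImbrieJaffe1985, (3.3) p.306] -/
def boltz (S : Action P i) : Dens P i := fun u φ => ((Real.exp (-S u φ) : ℝ) : ℂ)

/-- kernel: the value of `e^{−S}`. [cite: BalabanImbrieJaffe1985, (3.3) p.306] -/
@[simp] theorem boltz_apply (S : Action P i) (u : GaugeField P i U1) (φ : HiggsField P i) :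
    boltz S u φ = ((Real.exp (-S u φ) : ℝ) : ℂ) := rfl

/-- kernel: `Re e^{−S} = e^{−S}`. [cite: BalabanImbrieJaffe1985, (3.3) p.306] -/
theorem re_boltz (S : Action P i) (u : GaugeField P i U1) (φ : HiggsField P i) : (boltz S u φ).re = Real.exp (-S u φ) := by
  rw [boltz_apply, Complex.ofReal_re]

/-- kernel: `Im e^{−S} = 0`. [cite: BalabanImbrieJaffe1985, (3.3) p.306] -/
theorem im_boltz (S : Action P i) (u : GaugeField P i U1) (φ : HiggsField P i) : (boltz S u φ).im = 0 := by
  rw [boltz_apply, Complex.ofReal_im]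

/-- kernel: `e^{−S} > 0`. [cite: BalabanImbrieJaffe1985, (3.3) p.306] -/
theorem re_boltz_pos (S : Action P i) (u : GaugeField P i U1) (φ : HiggsField P i) : 0 < (boltz S u φ).re := by
  rw [re_boltz]; exact Real.exp_pos _

/-- kernel: `e^{−S} ≠ 0`. [cite: BalabanImbrieJaffe1985, (3.3) p.306] -/
theorem boltz_ne_zero (S : Action P i) (u : GaugeField P i U1) (φ : HiggsField P i) : boltz S u φ ≠ 0 := by
  rw [boltz_apply, Ne, Complex.ofReal_eq_zero]
  exact (Real.exp_pos _).ne'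

/-- **An action is recovered from its Boltzmann weight**: `−log Re e^{−S(u,φ)} = S(u, φ)` — the dictionary between the action-level display
(3.1) and the density-level transformation (3.2)–(3.3). [cite: BalabanImbrieJaffe1985, (3.1) p.306] -/
theorem neg_log_re_boltz (S : Action P i) (u : GaugeField P i U1) (φ : HiggsField P i) : -Real.log (boltz S u φ).re = S u φ := by
  rw [re_boltz, Real.log_exp, neg_neg]

/-- kernel: `e^{−S}` is jointly measurable in `(u, φ)` when `S` is. [cite: BalabanImbrieJaffe1985, (3.3) p.306] -/
theorem measurable_boltz {S : Action P i} (hS : Measurable (uncurry S)) : Measurable (uncurry (boltz S)) := by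
  have h : uncurry (boltz S) = fun z => ((Real.exp (-(uncurry S z)) : ℝ) : ℂ) := by
    funext z; rfl
  rw [h]
  exact Complex.measurable_ofReal.comp (Real.measurable_exp.comp hS.neg)

/-- kernel: `e^{−S}` is jointly gauge invariant when `S` is (`S(u^h, hφ) = S(u, φ)` for every `h : T → U(1)`, (2.7)).
[cite: BalabanImbrieJaffe1985, (3.3) p.306] -/
theorem jointInvariant_boltz {S : Action P i} (hS : JointInvariant S) : JointInvariant (boltz S) := by
  intro g U φ
  simp only [boltz_apply, hS g U φ]

/-! ## §2 (3.1)–(3.2): `R : S ↦ S^{(1)} = −log(𝒮_L𝒯 e^{−S})` on the torus carriers -/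

section RAction

variable (hi : i + 1 ≤ P.m + P.K) {a : ℝ} (ha : 0 < a) (hd : 2 ≤ P.d) (c : ℝ)

/-- **(3.1)–(3.2)** p. 306 [PDF 8], verbatim: *"The renormalization transformation R defines a mapping R : S → S^{(1)}, (3.1) where S, S^{(1)}
are both unit lattice actions. … Thus we can write R = 𝒮_L𝒯, (3.2)"* — AT ACTION LEVEL: `(R S)(v, ψ) = S^{(1)}(v, ψ) := −log Re (𝒮𝒯 e^{−S})(v, ψ)`,
with `𝒮𝒯` = p34's `BIJ88RTIterated.rgStep` (the Radon–Nikodym transform (3.3) over r18's printed block averages with the Gaussian `δ_H`,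
gauge-averaged, then the scaling `𝒮` of the block scalar field by `c`, printed `c = L^{−(d−2)/2}`); standing range `i + 1 ≤ m + K`, Gaussian
parameter `a > 0`, `d ≥ 2`. [cite: BalabanImbrieJaffe1985, (3.1) p.306] -/
def rAction (S : Action P i) : Action P (i + 1) := fun v ψ => -Real.log ((rgStep hi ha hd c (boltz S)) v ψ).re

/-- kernel: unfolding of `R S`. [cite: BalabanImbrieJaffe1985, (3.1) p.306] -/
theorem rAction_def (S : Action P i) (v : GaugeField P (i + 1) U1) (ψ : HiggsField P (i + 1)) :
    rAction hi ha hd c S v ψ = -Real.log ((rgStep hi ha hd c (boltz S)) v ψ).re := rfl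

/-- **`e^{−S^{(1)}} = R e^{−S}`** at every block configuration `(v, ψ)` where the density `(𝒮𝒯 e^{−S})(v, ψ)` is positive (its real part; see
HONEST SCOPE (i): positivity everywhere is not claimed). [cite: BalabanImbrieJaffe1985, (3.2) p.306] -/
theorem exp_neg_rAction (S : Action P i) {v : GaugeField P (i + 1) U1} {ψ : HiggsField P (i + 1)}
    (hpos : 0 < ((rgStep hi ha hd c (boltz S)) v ψ).re) :
    Real.exp (-(rAction hi ha hd c S v ψ)) = ((rgStep hi ha hd c (boltz S)) v ψ).re := by
  rw [rAction_def, neg_neg, Real.exp_log hpos]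

/-- kernel: conversely `S^{(1)}(v, ψ) = −log x` whenever `(𝒮𝒯 e^{−S})(v, ψ) = x` for a real `x`. [cite: BalabanImbrieJaffe1985, (3.2) p.306] -/
theorem rAction_eq_neg_log (S : Action P i) {v : GaugeField P (i + 1) U1} {ψ : HiggsField P (i + 1)} {x : ℝ}
    (hx : (rgStep hi ha hd c (boltz S)) v ψ = (x : ℂ)) : rAction hi ha hd c S v ψ = -Real.log x := by
  rw [rAction_def, hx, Complex.ofReal_re]

/-- **`S^{(1)}` is a measurable function of the block fields `(v, ψ)`** — for EVERY action `S` (the density of record is measurable by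
construction: `measurable_rtStep`, `measurable_scaleStep`). [cite: BalabanImbrieJaffe1985, (3.1) p.306] -/
theorem measurable_rAction (S : Action P i) : Measurable (uncurry (rAction hi ha hd c S)) := by
  have hm : Measurable (uncurry (rgStep hi ha hd c (boltz S))) :=
    measurable_scaleStep c (measurable_rtStep hi ha hd)
  have h : uncurry (rAction hi ha hd c S) = fun z => -Real.log (Complex.re (uncurry (rgStep hi ha hd c (boltz S)) z)) := by
    funext z; rfl
  rw [h]
  exact (Real.measurable_log.comp (Complex.measurable_re.comp hm)).neg

/-- **`S^{(1)}` is EXACTLY gauge invariant under the gauge group of the block lattice**: `S^{(1)}(v^h, hψ) = S^{(1)}(v, ψ)` for every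
`h : T^{(1)} → U(1)` and every action `S` — p. 306 *"They generate the gauge group of the integral 𝒯(exp −S)"*, for the (gauge-averaged,
a.e.-equal) density of record (`jointInvariant_rtStep`, `jointInvariant_scaleStep`). [cite: BalabanImbrieJaffe1985, (3.1) p.306] -/
theorem jointInvariant_rAction (S : Action P i) : JointInvariant (rAction hi ha hd c S) := by
  intro g v ψ
  unfold rAction BIJ88RTIterated.rgStep
  rw [jointInvariant_scaleStep c (jointInvariant_rtStep hi ha hd) g v ψ]

/-- **(3.7) for the Boltzmann weight**: `∫dv dψ (𝒮𝒯 e^{−S})(v, ψ) = ∫𝒟u𝒟φ e^{−S(u,φ)}` — for `S` jointly measurable and jointly gauge invariant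
with `e^{−S}` `𝒟u𝒟φ`-integrable, every `a > 0`, `c > 0` (p34's `rgStep_regular`; row C1.Eq3.7). [cite: BalabanImbrieJaffe1985, (3.7) p.306] -/
theorem integral_rgStep_boltz {c : ℝ} (hc : 0 < c) {S : Action P i} (hSm : Measurable (uncurry S)) (hSg : JointInvariant S)
    (hSi : Integrable (uncurry (boltz S)) ((fieldMeasure P i U1).prod volume)) :
    ∫ v, ∫ ψ, rgStep hi ha hd c (boltz S) v ψ ∂volume ∂fieldMeasure P (i + 1) U1 =
      ∫ U, ∫ φ, boltz S U φ ∂volume ∂fieldMeasure P i U1 :=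
  (rgStep_regular hi ha hd hc (measurable_boltz hSm) (jointInvariant_boltz hSg) hSi).2.2.2

/-- kernel: the density `R e^{−S}` is jointly measurable, exactly jointly gauge invariant and `dv dψ`-integrable (same hypotheses).
[cite: BalabanImbrieJaffe1985, (3.2) p.306] -/
theorem rgStep_boltz_regular {c : ℝ} (hc : 0 < c) {S : Action P i} (hSm : Measurable (uncurry S)) (hSg : JointInvariant S)
    (hSi : Integrable (uncurry (boltz S)) ((fieldMeasure P i U1).prod volume)) :
    Measurable (uncurry (rgStep hi ha hd c (boltz S))) ∧ JointInvariant (rgStep hi ha hd c (boltz S)) ∧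
      Integrable (uncurry (rgStep hi ha hd c (boltz S))) ((fieldMeasure P (i + 1) U1).prod volume) :=
  let h := rgStep_regular hi ha hd hc (measurable_boltz hSm) (jointInvariant_boltz hSg) hSi
  ⟨h.1, h.2.1, h.2.2.1⟩

/-- **(3.3) for the Boltzmann weight, in the push-forward reading**: the integration step `𝒯e^{−S}` (p34's `rtStep`, before the scaling)
satisfies r18's typed transformation `IsRT311 Qu Q(·)φ a e^{−S} (𝒯e^{−S})` with the PRINTED block averages (2.10)/(2.6) — for `S` jointly
measurable and jointly gauge invariant with `e^{−S}` integrable (p34's `isRT311_rtStep`). [cite: BalabanImbrieJaffe1985, (3.3) p.306] -/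
theorem isRT311_boltz {S : Action P i} (hSm : Measurable (uncurry S)) (hSg : JointInvariant S)
    (hSi : Integrable (uncurry (boltz S)) ((fieldMeasure P i U1).prod volume)) :
    IsRT311 qU qCov a (boltz S) (rtStep hi ha hd (boltz S)) :=
  isRT311_rtStep hi ha hd (measurable_boltz hSm) (jointInvariant_boltz hSg) hSi

end RAction

/-! ### `R` iterated: the action after `k` renormalization transformations (p. 309) -/

section Iter

variable {j : ℕ} (a : ℕ → ℝ) (ha : ∀ n, 0 < a n) (hd : 2 ≤ P.d) (c : ℕ → ℝ)

/-- **`S^{(k)} := −log Re (R^k e^{−S})`** — p. 309 [PDF 11]: *"the action which is produced after k renormalization transformations"*, at action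
level over p34's `rgIter` (Gaussian parameters `a_n > 0`, scalings `c_n`; standing range `j + k ≤ m + K`).
[cite: BalabanImbrieJaffe1985, (3.1) p.306] -/
def rActionIter (S : Action P j) (k : ℕ) (hk : j + k ≤ P.m + P.K) : Action P (j + k) :=
  fun v ψ => -Real.log ((rgIter a ha hd c (boltz S) k hk) v ψ).re

/-- kernel: no step returns the action itself: `S^{(0)} = S`. [cite: BalabanImbrieJaffe1985, (3.1) p.306] -/
theorem rActionIter_zero (S : Action P j) (h : j + 0 ≤ P.m + P.K) : rActionIter a ha hd c S 0 h = S := by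
  funext v ψ
  exact neg_log_re_boltz S v ψ

/-- kernel: `S^{(k)}` is jointly measurable, for `S` jointly measurable and jointly gauge invariant with `e^{−S}` integrable and all
`c_n > 0`. [cite: BalabanImbrieJaffe1985, (3.1) p.306] -/
theorem measurable_rActionIter (hc : ∀ n, 0 < c n) {S : Action P j} (hSm : Measurable (uncurry S)) (hSg : JointInvariant S)
    (hSi : Integrable (uncurry (boltz S)) ((fieldMeasure P j U1).prod volume)) (k : ℕ) (hk : j + k ≤ P.m + P.K) :
    Measurable (uncurry (rActionIter a ha hd c S k hk)) := by
  have hm := (rgIter_regular a ha hd c hc (measurable_boltz hSm) (jointInvariant_boltz hSg) hSi k hk).1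
  have h : uncurry (rActionIter a ha hd c S k hk) =
      fun z => -Real.log (Complex.re (uncurry (rgIter a ha hd c (boltz S) k hk) z)) := by
    funext z; rfl
  rw [h]
  exact (Real.measurable_log.comp (Complex.measurable_re.comp hm)).neg

/-- **`S^{(k)}` is exactly jointly gauge invariant** on the level-`(j+k)` lattice (same hypotheses). [cite: BalabanImbrieJaffe1985, (3.1) p.306] -/
theorem jointInvariant_rActionIter (hc : ∀ n, 0 < c n) {S : Action P j} (hSm : Measurable (uncurry S)) (hSg : JointInvariant S)
    (hSi : Integrable (uncurry (boltz S)) ((fieldMeasure P j U1).prod volume)) (k : ℕ) (hk : j + k ≤ P.m + P.K) :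
    JointInvariant (rActionIter a ha hd c S k hk) := by
  have hg := (rgIter_regular a ha hd c hc (measurable_boltz hSm) (jointInvariant_boltz hSg) hSi k hk).2.1
  intro g v ψ
  simp only [rActionIter]
  rw [hg g v ψ]

/-- **(3.7) along `R^k`**: `∫dv dψ (R^k e^{−S}) = ∫𝒟u𝒟φ e^{−S}` (same hypotheses). [cite: BalabanImbrieJaffe1985, (3.7) p.306] -/
theorem integral_rgIter_boltz (hc : ∀ n, 0 < c n) {S : Action P j} (hSm : Measurable (uncurry S)) (hSg : JointInvariant S)
    (hSi : Integrable (uncurry (boltz S)) ((fieldMeasure P j U1).prod volume)) (k : ℕ) (hk : j + k ≤ P.m + P.K) :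
    ∫ v, ∫ ψ, rgIter a ha hd c (boltz S) k hk v ψ ∂volume ∂fieldMeasure P (j + k) U1 =
      ∫ U, ∫ φ, boltz S U φ ∂volume ∂fieldMeasure P j U1 :=
  (rgIter_regular a ha hd c hc (measurable_boltz hSm) (jointInvariant_boltz hSg) hSi k hk).2.2.2

end Iter

/-! ## §3 Print's instance: `S` = the unit-lattice action (1.1) of this paper -/

section Model

variable {j : ℕ}

/-- **`e^{−S}` for `S` = (1.1) IS r18's density `ρ₀` of [BalabanImbrieJaffe1988] (3.7) at `ε = 1` with the observable `1`** (through r15 gen 11's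
bridge `S11_eq_actionU1_one`: couplings `e(ε)`, `λ(ε)`, mass shift `(μ² − 1)/2`, constant `E − |T|/(64λ(ε))`, `E₁ = 0`; at `ε = 1` the rescaling
`ε^{−(d−2)/2}` and the `log ε⁻¹` shift of `ℰ₀` are trivial). [cite: BalabanImbrieJaffe1985, (3.3) p.306] -/
theorem boltz_S11_eq_rho0 (eε lamε μsq E : ℝ) :
    boltz (S11 (P := P) (j := j) eε lamε μsq E) =
      rho0 1 eε lamε ((μsq - 1) / 2) (E - Fintype.card (Balaban1983to89.Site P j) / (64 * lamε)) 0 (fun _ _ => (1 : ℂ)) := by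
  funext U φ
  rw [rho0_one, boltz_apply, S11_eq_actionU1_one]
  have hs : BIJ88Sect3Rescaling.phiScale 1 P.d = 1 := by simp [BIJ88Sect3Rescaling.phiScale]
  have hE : calE0 (E - Fintype.card (Balaban1983to89.Site P j) / (64 * lamε)) P.d (Fintype.card (Balaban1983to89.Site P j)) 1 =
      E - Fintype.card (Balaban1983to89.Site P j) / (64 * lamε) := by simp [calE0]
  rw [hs, one_smul, hE]

/-- kernel: `e^{−S}` for `S` = (1.1) is jointly measurable. [cite: BalabanImbrieJaffe1985, (3.3) p.306] -/
theorem measurable_boltz_S11 (eε lamε μsq E : ℝ) : Measurable (uncurry (boltz (S11 (P := P) (j := j) eε lamε μsq E))) := by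
  rw [boltz_S11_eq_rho0]
  exact measurable_rho0 _ _ _ _ _ _ measurable_const

/-- kernel: `e^{−S}` for `S` = (1.1) is jointly gauge invariant ((1.1) is gauge invariant; r18's `rho0_gaugeAct`). [cite: BalabanImbrieJaffe1985, (3.3) p.306] -/
theorem jointInvariant_boltz_S11 (eε lamε μsq E : ℝ) : JointInvariant (boltz (S11 (P := P) (j := j) eε lamε μsq E)) := by
  rw [boltz_S11_eq_rho0]
  intro g U φ
  exact rho0_gaugeAct _ _ _ _ _ _ (fun _ _ _ => rfl) g U φ

/-- kernel: the action (1.1) itself is jointly gauge invariant on the carrier of record (from the invariance of `e^{−S}`, `exp` injective).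
[cite: BalabanImbrieJaffe1985, (1.1) p.300] -/
theorem jointInvariant_S11 (eε lamε μsq E : ℝ) : JointInvariant (S11 (P := P) (j := j) eε lamε μsq E) := by
  intro g U φ
  have h := jointInvariant_boltz_S11 (P := P) (j := j) eε lamε μsq E g U φ
  rw [← neg_log_re_boltz (S11 eε lamε μsq E) (gaugeAct g U) (twist g φ), h, neg_log_re_boltz]

/-- **`e^{−S}` for `S` = (1.1) is `𝒟u𝒟φ`-integrable** for `λ(ε) > 0` (every `e(ε)`, `μ²`, `E`, every torus) — r18's stability bound
`integrable_rho0_one` at `ε = 1`. [cite: BalabanImbrieJaffe1985, (3.3) p.306] -/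
theorem integrable_boltz_S11 (eε : ℝ) {lamε : ℝ} (hlam : 0 < lamε) (μsq E : ℝ) :
    Integrable (uncurry (boltz (S11 (P := P) (j := j) eε lamε μsq E))) ((fieldMeasure P j U1).prod volume) := by
  rw [boltz_S11_eq_rho0]
  exact integrable_rho0_one one_pos eε hlam _ _ _

variable (hj : j + 1 ≤ P.m + P.K) {a : ℝ} (ha : 0 < a) (hd : 2 ≤ P.d)

/-- **THE FIRST RENORMALIZATION STEP OF THE MODEL, (3.1)**: `S^{(1)} := R S` for `S` = the unit-lattice action (1.1) with couplings `e(ε)`,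
`λ(ε)`, `μ² = (m² + δm²)ε²`, `E` (Gaussian parameter `a > 0`, scaling `c`, printed `c = L^{−(d−2)/2}`; `d ≥ 2`, `j + 1 ≤ m + K`).
[cite: BalabanImbrieJaffe1985, (3.1) p.306] -/
def S1 (c eε lamε μsq E : ℝ) : Action P (j + 1) := rAction hj ha hd c (S11 eε lamε μsq E)

/-- kernel: `S^{(1)}` of the model is a measurable function of the block fields. [cite: BalabanImbrieJaffe1985, (3.1) p.306] -/
theorem measurable_S1 (c eε lamε μsq E : ℝ) : Measurable (uncurry (S1 hj ha hd c eε lamε μsq E)) :=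
  measurable_rAction hj ha hd c _

/-- kernel: `S^{(1)}` of the model is exactly gauge invariant on the block lattice. [cite: BalabanImbrieJaffe1985, (3.1) p.306] -/
theorem jointInvariant_S1 (c eε lamε μsq E : ℝ) : JointInvariant (S1 hj ha hd c eε lamε μsq E) :=
  jointInvariant_rAction hj ha hd c _

/-- **(3.7) for the model's first step**: `∫dv dψ (R e^{−S})(v, ψ) = ∫𝒟u𝒟φ e^{−S(u,φ)}` for `S` = (1.1), every `λ(ε) > 0`, `a > 0`, `c > 0`.
[cite: BalabanImbrieJaffe1985, (3.7) p.306] -/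
theorem integral_R_exp_neg_S11 {c : ℝ} (hc : 0 < c) (eε : ℝ) {lamε : ℝ} (hlam : 0 < lamε) (μsq E : ℝ) :
    ∫ v, ∫ ψ, rgStep hj ha hd c (boltz (S11 eε lamε μsq E)) v ψ ∂volume ∂fieldMeasure P (j + 1) U1 =
      ∫ U, ∫ φ, boltz (S11 (P := P) (j := j) eε lamε μsq E) U φ ∂volume ∂fieldMeasure P j U1 :=
  (rgStep_regular hj ha hd hc (measurable_boltz_S11 eε lamε μsq E) (jointInvariant_boltz_S11 eε lamε μsq E)
    (integrable_boltz_S11 eε hlam μsq E)).2.2.2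

/-- **(3.3) applied to `e^{−S}`, `S` = (1.1)**: `IsRT311 Qu Q(·)φ a e^{−S} (𝒯e^{−S})` for the model (every `e(ε)`, `μ²`, `E`, `λ(ε) > 0`,
`a > 0`, `d ≥ 2`). [cite: BalabanImbrieJaffe1985, (3.3) p.306] -/
theorem isRT311_exp_neg_S11 (eε : ℝ) {lamε : ℝ} (hlam : 0 < lamε) (μsq E : ℝ) :
    IsRT311 qU qCov a (boltz (S11 (P := P) (j := j) eε lamε μsq E)) (rtStep hj ha hd (boltz (S11 eε lamε μsq E))) :=
  isRT311_rtStep hj ha hd (measurable_boltz_S11 eε lamε μsq E) (jointInvariant_boltz_S11 eε lamε μsq E)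
    (integrable_boltz_S11 eε hlam μsq E)

/-- kernel: where the model's renormalized density is positive, `e^{−S^{(1)}(v,ψ)} = (R e^{−S})(v, ψ)`. [cite: BalabanImbrieJaffe1985, (3.2) p.306] -/
theorem exp_neg_S1 (c eε lamε μsq E : ℝ) {v : GaugeField P (j + 1) U1} {ψ : HiggsField P (j + 1)}
    (hpos : 0 < ((rgStep hj ha hd c (boltz (S11 eε lamε μsq E))) v ψ).re) :
    Real.exp (-(S1 hj ha hd c eε lamε μsq E v ψ)) = ((rgStep hj ha hd c (boltz (S11 eε lamε μsq E))) v ψ).re :=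
  exp_neg_rAction hj ha hd c _ hpos

/-- kernel: the action (1.1) is jointly measurable on the carrier of record (`S = −log Re e^{−S}` with `e^{−S}` measurable).
[cite: BalabanImbrieJaffe1985, (1.1) p.300] -/
theorem measurable_S11 (eε lamε μsq E : ℝ) : Measurable (uncurry (S11 (P := P) (j := j) eε lamε μsq E)) := by
  have h : uncurry (S11 (P := P) (j := j) eε lamε μsq E) =
      fun z => -Real.log (Complex.re (uncurry (boltz (S11 eε lamε μsq E)) z)) := by
    funext z
    exact (neg_log_re_boltz (S11 eε lamε μsq E) z.1 z.2).symm
  rw [h]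
  exact (Real.measurable_log.comp (Complex.measurable_re.comp (measurable_boltz_S11 eε lamε μsq E))).neg

end Model

section ModelIter

variable {j : ℕ} (a : ℕ → ℝ) (ha : ∀ n, 0 < a n) (hd : 2 ≤ P.d) (c : ℕ → ℝ)

/-- **THE MODEL'S ACTION AFTER `k` RENORMALIZATION TRANSFORMATIONS**, p. 309 [PDF 11] *"the action which is produced after k renormalization
transformations"*: `S^{(k)} := −log Re (R^k e^{−S})` for `S` = the unit-lattice action (1.1) (Gaussian parameters `a_n > 0`, scalings `c_n`,
printed `c = L^{−(d−2)/2}`; `j + k ≤ m + K`). [cite: BalabanImbrieJaffe1985, (3.1) p.306] -/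
def Sk (eε lamε μsq E : ℝ) (k : ℕ) (hk : j + k ≤ P.m + P.K) : Action P (j + k) :=
  rActionIter a ha hd c (S11 eε lamε μsq E) k hk

/-- kernel: `S^{(0)} = S` for the model. [cite: BalabanImbrieJaffe1985, (3.1) p.306] -/
theorem Sk_zero (eε lamε μsq E : ℝ) (h : j + 0 ≤ P.m + P.K) : Sk a ha hd c eε lamε μsq E 0 h = S11 eε lamε μsq E :=
  rActionIter_zero a ha hd c _ h

/-- kernel: `S^{(k)}` of the model is jointly measurable (`λ(ε) > 0`, all `c_n > 0`). [cite: BalabanImbrieJaffe1985, (3.1) p.306] -/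
theorem measurable_Sk (hc : ∀ n, 0 < c n) (eε : ℝ) {lamε : ℝ} (hlam : 0 < lamε) (μsq E : ℝ) (k : ℕ) (hk : j + k ≤ P.m + P.K) :
    Measurable (uncurry (Sk a ha hd c eε lamε μsq E k hk)) :=
  measurable_rActionIter a ha hd c hc (measurable_S11 eε lamε μsq E) (jointInvariant_S11 eε lamε μsq E)
    (integrable_boltz_S11 eε hlam μsq E) k hk

/-- kernel: `S^{(k)}` of the model is exactly jointly gauge invariant on the level-`(j+k)` lattice (`λ(ε) > 0`, all `c_n > 0`).
[cite: BalabanImbrieJaffe1985, (3.1) p.306] -/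
theorem jointInvariant_Sk (hc : ∀ n, 0 < c n) (eε : ℝ) {lamε : ℝ} (hlam : 0 < lamε) (μsq E : ℝ) (k : ℕ) (hk : j + k ≤ P.m + P.K) :
    JointInvariant (Sk a ha hd c eε lamε μsq E k hk) :=
  jointInvariant_rActionIter a ha hd c hc (measurable_S11 eε lamε μsq E) (jointInvariant_S11 eε lamε μsq E)
    (integrable_boltz_S11 eε hlam μsq E) k hk

/-- **(3.7) along the model's `R^k`**: `∫dv dψ (R^k e^{−S})(v, ψ) = ∫𝒟u𝒟φ e^{−S(u,φ)}` for `S` = (1.1) (`λ(ε) > 0`, all `a_n, c_n > 0`, `d ≥ 2`,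
`j + k ≤ m + K`). [cite: BalabanImbrieJaffe1985, (3.7) p.306] -/
theorem integral_Rk_exp_neg_S11 (hc : ∀ n, 0 < c n) (eε : ℝ) {lamε : ℝ} (hlam : 0 < lamε) (μsq E : ℝ) (k : ℕ)
    (hk : j + k ≤ P.m + P.K) :
    ∫ v, ∫ ψ, rgIter a ha hd c (boltz (S11 eε lamε μsq E)) k hk v ψ ∂volume ∂fieldMeasure P (j + k) U1 =
      ∫ U, ∫ φ, boltz (S11 (P := P) (j := j) eε lamε μsq E) U φ ∂volume ∂fieldMeasure P j U1 :=
  integral_rgIter_boltz a ha hd c hc (measurable_S11 eε lamε μsq E) (jointInvariant_S11 eε lamε μsq E)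
    (integrable_boltz_S11 eε hlam μsq E) k hk

end ModelIter

/-! ## §4 The `δ_H` of record IS (3.6): r18's normalized Gaussian `gaussApprox a` = p34's `deltaH (aL^{d−2})` -/

section DeltaH

variable {j : ℕ}

/-- **(3.6) verbatim for the transformation of record**: r18's normalized block Gaussian of [BalabanImbrieJaffe1988] (3.11)–(3.12),
`exp(−½aL⁻²⟨ψ − c, ψ − c⟩ − E^{(0)})` with `⟨f, g⟩ = Σ_y L^d f̄(y)g(y)` and `E^{(0)} = −|T₁^{(1)}| log(aL^{d−2}/2π)`, EQUALS print's (3.6)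
`Π_y (a′/2π) exp(−½a′|ψ(y) − c(y)|²)` (p34's `deltaHKernel`) at `a′ = aL^{d−2}` — every centre `c`, every `ψ`, every `a > 0` (`d ≥ 2`).
[cite: BalabanImbrieJaffe1985, (3.6) p.306] -/
theorem gaussWeight_eq_deltaHKernel {a : ℝ} (ha : 0 < a) (hd : 2 ≤ P.d) (c ψ : HiggsField P (j + 1)) :
    gaussWeight (P := P) (j := j) a c ψ = deltaHKernel (a * (P.L : ℝ) ^ (P.d - 2)) c ψ := by
  have hL : (0 : ℝ) < P.L := P.cast_L_pos
  set a' : ℝ := a * (P.L : ℝ) ^ (P.d - 2) with ha'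
  have ha'pos : 0 < a' := mul_pos ha (pow_pos hL _)
  have hq : 0 < a' / (2 * Real.pi) := div_pos ha'pos (by positivity)
  have hpow : a * ((P.L : ℝ)⁻¹) ^ 2 * (P.L : ℝ) ^ P.d = a' := by
    obtain ⟨k, hk⟩ := Nat.exists_eq_add_of_le hd
    rw [ha', hk, Nat.add_sub_cancel_left, pow_add]
    field_simp
  unfold gaussWeight deltaHKernel siteGauss E0step
  rw [Finset.prod_mul_distrib, Finset.prod_const, Finset.card_univ]
  have hexp : ∏ y : Balaban1983to89.Site P (j + 1), Real.exp (-(a' / 2) * ‖ψ y - c y‖ ^ 2) =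
      Real.exp (∑ y : Balaban1983to89.Site P (j + 1), -(a' / 2) * ‖ψ y - c y‖ ^ 2) := by
    rw [Real.exp_sum]
  rw [hexp]
  have hconst : (a' / (2 * Real.pi)) ^ Fintype.card (Balaban1983to89.Site P (j + 1)) =
      Real.exp ((Fintype.card (Balaban1983to89.Site P (j + 1)) : ℝ) * Real.log (a' / (2 * Real.pi))) := by
    rw [← Real.log_pow, Real.exp_log (pow_pos hq _)]
  rw [hconst, ← Real.exp_add]
  congr 1
  have hsum : -(1 / 2) * (a * ((P.L : ℝ)⁻¹) ^ 2) * ∑ y : Balaban1983to89.Site P (j + 1), (P.L : ℝ) ^ P.d * ‖ψ y - c y‖ ^ 2 =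
      ∑ y : Balaban1983to89.Site P (j + 1), -(a' / 2) * ‖ψ y - c y‖ ^ 2 := by
    rw [Finset.mul_sum]
    refine Finset.sum_congr rfl fun y _ => ?_
    rw [← hpow]
    ring
  rw [hsum]
  ring

/-- kernel: two approximate δ-functions with the same kernel are the same datum (the other fields are proofs).
[cite: BalabanImbrieJaffe1985, (3.6) p.306] -/
theorem approxDelta_eq_of_K {A B : ApproxDelta P j} (h : A.K = B.K) : A = B := by
  cases A; cases B; cases h; rfl

/-- **The `δ_H` of every consumer of record IS (3.6)**: `gaussApprox a = deltaH (aL^{d−2})` as approximate δ-functions (`a > 0`, `d ≥ 2`) —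
so the transformation `𝒯` inside `rtStep`/`rgStep`/`rAction` is (3.3) with the printed (3.6), the free parameter renamed.
[cite: BalabanImbrieJaffe1985, (3.6) p.306] -/
theorem gaussApprox_eq_deltaH {a : ℝ} (ha : 0 < a) (hd : 2 ≤ P.d) :
    gaussApprox (P := P) (j := j) ha hd =
      deltaH (P := P) (j := j) (a := a * (P.L : ℝ) ^ (P.d - 2)) (mul_pos ha (pow_pos P.cast_L_pos _)) := by
  apply approxDelta_eq_of_K
  funext c ψ
  exact gaussWeight_eq_deltaHKernel ha hd c ψ

/-- **p34's step, spelled with (3.6)**: `rtStep ρ = gaugeAvg (𝒯ρ)` where `𝒯` is p34's Radon–Nikodym transform (3.3) over r18's printed block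
averages with `δ_H = deltaH (aL^{d−2})` — (3.3)–(3.6) verbatim, then the gauge average. [cite: BalabanImbrieJaffe1985, (3.3) p.306] -/
theorem rtStep_eq_deltaH (hi : i + 1 ≤ P.m + P.K) {a : ℝ} (ha : 0 < a) (hd : 2 ≤ P.d) (ρ : Dens P i) :
    rtStep hi ha hd ρ = gaugeAvg ((torusRTData hi).rt (deltaH (mul_pos ha (pow_pos P.cast_L_pos (P.d - 2)))) ρ) := by
  unfold rtStep
  rw [gaussApprox_eq_deltaH ha hd]

/-- Hence **`S^{(1)} = −log Re 𝒮_L[gaugeAvg 𝒯_{(3.6)} e^{−S}]`** with the printed `δ_H` (3.6) at `a′ = aL^{d−2}` — (3.1)–(3.3) end to end on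
the torus carriers. [cite: BalabanImbrieJaffe1985, (3.1) p.306] -/
theorem rAction_eq_deltaH (hi : i + 1 ≤ P.m + P.K) {a : ℝ} (ha : 0 < a) (hd : 2 ≤ P.d) (c : ℝ) (S : Action P i)
    (v : GaugeField P (i + 1) U1) (ψ : HiggsField P (i + 1)) :
    rAction hi ha hd c S v ψ =
      -Real.log ((scaleStep c (gaugeAvg ((torusRTData hi).rt (deltaH (mul_pos ha (pow_pos P.cast_L_pos (P.d - 2)))) (boltz S)))) v ψ).re := by
  rw [rAction_def]
  unfold BIJ88RTIterated.rgStep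
  rw [rtStep_eq_deltaH]

end DeltaH

end

end Literature.MathematicalPhysics.QuantumFieldTheory.BalabanImbrieJaffe1984to88.BIJ85Eq31ActionMap
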